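import Summits.ResolutionOfSingularities.ResolutionOfSingularities.Theorems.EquisingularLiftEquisingularLiftNatP1VBPicProjectiveLine
import Literature.AlgebraicGeometry.Morphisms.CechModuleShortExact
import Literature.AlgebraicGeometry.FundamentalGroup.ProjectiveLineCharts
import HarnessLib

/-!
# [OURS · L1 W4.5(b) · T-P1VB part 8] `Ȟ¹ = 0` transfers along short exact sequences on an affine cover, and
# `Ȟ¹((D₊x₀, D₊x₁); 𝒪_{ℙ¹_k}) = 0`

Cell res-hironaka, LADDER-RESOLUTION rung L (D-0089), slot W4.5(b), crux `Theses.EquisingularLift.EquisingularLiftNat`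
(stmt-ResolutionOfSingularities-20038) / child `EquisingularLiftNatThree` (stmt-ResolutionOfSingularities-20148); object **T-P1VB**
(res-L1-w45b-lead-2 BOOK 2026-08-27T09:28:20Z; supplier debt (b) of `Theorems/…NatDirZeroDefs.lean` (`DirStepUnobs`): «H¹(𝓗om(K₀,
𝒞_k/K₀)) = 0 ⇒ H¹(𝓗om(K₀, 𝒞_k)) = 0 on the rational carrier», via `0 → 𝒪 → 𝓗om(K₀,𝒞_k) → 𝓗om(K₀,𝒞_k/K₀) → 0` and `H¹(ℙ¹, 𝒪) = 0`),
`--supports stmt-ResolutionOfSingularities-20148 --as helper`. NOT a statement of any manuscript; OURS. AI-written; AI review is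
weaker than expert review.

WHAT (all in the tree's Čech currency `Morphisms/CechModule.CechMH1`).
* `subsingleton_cechMH1_of_shortExact` — for `0 → M′ → M → M″ → 0` short exact in `X.Modules`, `M′` affine-localizing
  (quasi-coherent), and a family of AFFINE opens: `Ȟ¹(𝒰; M′) = 0 ∧ Ȟ¹(𝒰; M″) = 0 ⇒ Ȟ¹(𝒰; M) = 0` (exactness at `Ȟ¹(M)`, tree
  `Morphisms/CechModuleShortExact.CechExactData.of_shortExact` + `CechModuleExact.exists_cechMapH1_eq`);
* `subsingleton_cechMH1_of_epi_fin_two` — on a TWO-member family with `U₀ ∩ U₁` affine: `Ȟ¹(𝒰; M) = 0 ⇒ Ȟ¹(𝒰; M″) = 0`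
  (right exactness of `Ȟ¹` on two charts: part 2a `subsingleton_cechMH1_iff` + tree `app_surjective_of_shortExact`);
* `exists_res₀_add_res₁` — Laurent decomposition `k[t,t⁻¹] = k[t] + k[t⁻¹]` in `(k[x]_{x₀x₁})₀` (tree
  `FundamentalGroup/ProjectiveLineCharts`: basis `ℓ j = tʲ`, `range_res₀/₁`); `exists_add_of_basicOpen_mul` — every function on
  `D₊(x₀x₁) ⊆ ℙ¹_k` is a sum of functions on `D₊(x₀)` and `D₊(x₁)` (Mathlib `Proj.awayMap_awayToSection`, `basicOpenIsoAway`);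
  `exists_cechDelta_eq_unit` — the same in the `Dplus`/`CechMC0` spelling;
* **`subsingleton_cechMH1_unit_projectiveLine`** — `Subsingleton (CechMH1 (toSpec k 1) (unitModule (PP k 1)) (fun i : Fin 2 =>
  Dplus k 1 {i}))`: **`Ȟ¹` of the structure sheaf of `ℙ¹_k` on the two standard charts vanishes** (Hartshorne III Thm. 5.1,
  `r = 1`, `n = 0`).
USE (supplier of v8 DIR₀): with `S : 0 → 𝒪_{ℙ¹_k} ≅ 𝓗om(K₀,K₀) → 𝓗om(K₀,𝒞_k) → 𝓗om(K₀,𝒞_k/K₀) → 0` (exact: `K₀` a line bundle,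
tree `Modules/SheafHomExact`) and the `Fin 2` standard cover, `subsingleton_cechMH1_of_shortExact` turns `DirStepUnobs`-type
vanishing for the quotient into the hypothesis of `P1VB.exists_nowhereVanishing_lift_projectiveLine`.

References (index only): Hartshorne II Prop. 5.6, III Thm. 4.5 (proof), III Thm. 5.1; Görtz–Wedhorn I §(11.17).
-/

noncomputable section

-- `TopCat.Presheaf`/`Scheme.Modules` are not reducible (as in Mathlib's `AlgebraicGeometry/Modules`).
set_option backward.isDefEq.respectTransparency false

open CategoryTheory AlgebraicGeometry TopologicalSpace Opposite
open Literature.AlgebraicGeometry.Morphisms Literature.AlgebraicGeometry.Modules Literature.AlgebraicGeometry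
open Literature.Algebra.Homology.LaurentCech (Xs Xs_mem Xs_singleton)

attribute [local instance] MvPolynomial.gradedAlgebra Literature.AlgebraicGeometry.Motives.ProjBaseChange.algebraBase

set_option linter.dupNamespace false -- mandated namespace `Summit.<Summit>.<Problem>` of this single-conjunct summit

namespace Summit.ResolutionOfSingularities.ResolutionOfSingularities.Cruxes.EquisingularLiftNat.P1VB

/-! ### Vanishing of `Ȟ¹` passes through short exact sequences (affine cover, quasi-coherent kernel) -/

section Transfer

universe u

variable {A : Type u} [CommRing A] {X : Scheme.{u}} (f : X ⟶ Spec (.of A)) {ι : Type u} (U : ι → X.Opens)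

/-- **Two-out-of-three for `Ȟ¹ = 0`**: for a short exact `0 → M′ → M → M″ → 0` of `𝒪_X`-modules with `M′` affine-localizing
(e.g. quasi-coherent) and a family of AFFINE opens, `Ȟ¹(𝒰; M′) = 0` and `Ȟ¹(𝒰; M″) = 0` give `Ȟ¹(𝒰; M) = 0`
(exactness of `Ȟ¹(M′) → Ȟ¹(M) → Ȟ¹(M″)`, tree `Morphisms/CechModuleExact` + `CechModuleShortExact`). [folklore] -/
theorem subsingleton_cechMH1_of_shortExact {S : ShortComplex X.Modules} (hS : S.ShortExact)
    (h₁ : IsAffineLocalizing S.X₁) (hU : ∀ i, IsAffineOpen (U i))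
    (hH₁ : Subsingleton (CechMH1 f S.X₁ U)) (hH₃ : Subsingleton (CechMH1 f S.X₃ U)) :
    Subsingleton (CechMH1 f S.X₂ U) := by
  have hD := CechExactData.of_shortExact f U hS h₁ hU
  refine ⟨fun y y' => ?_⟩
  suffices h0 : ∀ y : CechMH1 f S.X₂ U, y = 0 by rw [h0 y, h0 y']
  intro y
  obtain ⟨z, hz⟩ := hD.exists_cechMapH1_eq y (Subsingleton.elim _ _)
  rw [← hz, Subsingleton.elim z 0, map_zero]

/-- Conversely `Ȟ¹(𝒰; M) = 0` gives `Ȟ¹(𝒰; M″) = 0` when in addition `Ȟ²`… — NOT needed here; we record only the monotone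
direction `Ȟ¹(𝒰; M) = 0 ⇒ Ȟ¹(𝒰; M″) = 0` for a TWO-member affine cover, where `Ȟ¹` is right exact (part 2a: every section over
`U₀ ∩ U₁` of `M″` lifts to `M` over the affine `U₀ ∩ U₁`, and differences for `M` descend). [folklore] -/
theorem subsingleton_cechMH1_of_epi_fin_two (U : Fin 2 → X.Opens) {S : ShortComplex X.Modules} (hS : S.ShortExact)
    (h₁ : IsAffineLocalizing S.X₁) (hU01 : IsAffineOpen (U 0 ⊓ U 1))
    (hH₂ : Subsingleton (CechMH1 f S.X₂ U)) : Subsingleton (CechMH1 f S.X₃ U) := by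
  rw [subsingleton_cechMH1_iff] at hH₂ ⊢
  intro y
  obtain ⟨m, hm⟩ := app_surjective_of_shortExact hS h₁ hU01 y
  obtain ⟨b, hb⟩ := hH₂ m
  refine ⟨cechMapC0 f S.g U b, ?_⟩
  rw [cechDelta_eq, cechMD0_mapC0, cechMapC1_apply, ← cechDelta_eq, hb]
  exact hm

end Transfer

/-! ### `Ȟ¹` of the structure sheaf of `ℙ¹_k` on the two standard charts vanishes -/

section StructureSheaf

variable (k : Type) [Field k]

open Literature.AlgebraicGeometry.FundamentalGroup

/-- **Laurent decomposition**: every element of `(k[x₀,x₁]_{x₀x₁})₀ = k[t, t⁻¹]` is `res₀ p + res₁ q` with `p ∈ (k[x]_{x₀})₀ = k[t]`,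
`q ∈ (k[x]_{x₁})₀ = k[t⁻¹]` (split the expansion in the basis `ℓ j = tʲ` at `j ≥ 0` / `j < 0`; tree
`ProjectiveLineCharts.range_res₀/₁`). [folklore] -/
theorem exists_res₀_add_res₁ (x : HomogeneousLocalization.Away (MvPolynomial.homogeneousSubmodule (Fin 2) k)
      (MvPolynomial.X 0 * MvPolynomial.X 1 : MvPolynomial (Fin 2) k)) :
    ∃ p q, x = P1Charts.res₀ k p + P1Charts.res₁ k q := by
  classical
  -- expand `x` in the basis `ℓ`
  have hx : x = ((P1Charts.ℓ k).repr x).sum (fun j c => c • P1Charts.ℓ k j) := by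
    rw [← Finsupp.linearCombination_apply, Module.Basis.linearCombination_repr]
  set c := (P1Charts.ℓ k).repr x with hc
  have hsplit : (c.sum fun j a => a • P1Charts.ℓ k j) =
      ((c.filter fun j => 0 ≤ j).sum fun j a => a • P1Charts.ℓ k j) +
        ((c.filter fun j => ¬ 0 ≤ j).sum fun j a => a • P1Charts.ℓ k j) := by
    conv_lhs => rw [← Finsupp.filter_add_filter_not c (fun j => 0 ≤ j)]
    exact Finsupp.sum_add_index' (fun j => zero_smul k (P1Charts.ℓ k j)) (fun j a b => add_smul a b (P1Charts.ℓ k j))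
  have hpos : ((c.filter fun j => 0 ≤ j).sum fun j a => a • P1Charts.ℓ k j) ∈ Set.range (P1Charts.res₀ k) := by
    rw [P1Charts.range_res₀, SetLike.mem_coe]
    refine Submodule.finsuppSum_mem _ _ _ _ fun j hj => ?_
    refine Submodule.smul_mem _ _ (Submodule.subset_span (Set.mem_image_of_mem _ ?_))
    rw [Finsupp.filter_apply] at hj
    by_contra h'
    exact hj (if_neg h')
  have hneg : ((c.filter fun j => ¬ 0 ≤ j).sum fun j a => a • P1Charts.ℓ k j) ∈ Set.range (P1Charts.res₁ k) := by
    rw [P1Charts.range_res₁, SetLike.mem_coe]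
    refine Submodule.finsuppSum_mem _ _ _ _ fun j hj => ?_
    refine Submodule.smul_mem _ _ (Submodule.subset_span (Set.mem_image_of_mem _ ?_))
    rw [Finsupp.filter_apply] at hj
    by_contra h'
    exact hj (if_neg fun h'' => h' (le_of_lt (not_le.mp h'')))
  obtain ⟨p, hp⟩ := hpos
  obtain ⟨q, hq⟩ := hneg
  exact ⟨p, q, by rw [hx, hsplit, hp, hq]⟩

/-- **Every function on `D₊(x₀x₁) ⊆ ℙ¹_k` is a sum of a function on `D₊(x₀)` and one on `D₊(x₁)`** (`X`-spelling of the charts).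
[folklore] -/
theorem exists_add_of_basicOpen_mul (y : Γ(ProjCech.PP k 1, Proj.basicOpen (ProjCech.grading k 1)
      (MvPolynomial.X 0 * MvPolynomial.X 1 : MvPolynomial (Fin 2) k))) :
    ∃ (p : Γ(ProjCech.PP k 1, Proj.basicOpen (ProjCech.grading k 1) (MvPolynomial.X 0 : MvPolynomial (Fin 2) k)))
      (q : Γ(ProjCech.PP k 1, Proj.basicOpen (ProjCech.grading k 1) (MvPolynomial.X 1 : MvPolynomial (Fin 2) k))),
      y = (ProjCech.PP k 1).presheaf.map (homOfLE (Proj.basicOpen_mono _ _ _ ⟨_, rfl⟩)).op p +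
        (ProjCech.PP k 1).presheaf.map (homOfLE (Proj.basicOpen_mono _ _ _ ⟨_, mul_comm _ _⟩)).op q := by
  -- `y = awayToSection x`
  have hsurj : Function.Surjective (Proj.awayToSection (ProjCech.grading k 1)
      (MvPolynomial.X 0 * MvPolynomial.X 1 : MvPolynomial (Fin 2) k)) :=
    (ConcreteCategory.bijective_of_isIso (Proj.basicOpenIsoAway (ProjCech.grading k 1)
      (MvPolynomial.X 0 * MvPolynomial.X 1 : MvPolynomial (Fin 2) k)
      (SetLike.mul_mem_graded (Motives.Segre.X_mem k 0) (Motives.Segre.X_mem k 1)) (by norm_num)).hom).2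
  obtain ⟨x, rfl⟩ := hsurj y
  obtain ⟨p, q, rfl⟩ := exists_res₀_add_res₁ k x
  refine ⟨Proj.awayToSection _ _ p, Proj.awayToSection _ _ q, ?_⟩
  have h0 := Proj.awayMap_awayToSection (ProjCech.grading k 1) (Motives.Segre.X_mem k (1 : Fin 2)) (P1Charts.hx₀ k)
  have h1 := Proj.awayMap_awayToSection (ProjCech.grading k 1) (Motives.Segre.X_mem k (0 : Fin 2)) (P1Charts.hx₁ k)
  have h0' := congrArg (fun φ => φ.hom p) h0
  have h1' := congrArg (fun φ => φ.hom q) h1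
  simp only [CommRingCat.hom_comp, RingHom.coe_comp, Function.comp_apply, CommRingCat.hom_ofHom] at h0' h1'
  rw [map_add]
  exact congrArg₂ (· + ·) h0' h1'

/-- The same in the `Dplus` spelling of the tree's Čech files: every section over `D₊(X_{{0}}) ∩ D₊(X_{{1}})` is a
difference `b₁| − b₀|` of sections over the two charts. [folklore] -/
theorem exists_cechDelta_eq_unit (y : MSections (ProjCech.toSpec k 1) (unitModule (ProjCech.PP k 1))
      (ProjCech.Dplus k 1 {0} ⊓ ProjCech.Dplus k 1 {1})) :
    ∃ b : CechMC0 (ProjCech.toSpec k 1) (unitModule (ProjCech.PP k 1)) (fun i : Fin 2 => ProjCech.Dplus k 1 {i}),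
      cechDelta (ProjCech.toSpec k 1) (unitModule (ProjCech.PP k 1)) (fun i : Fin 2 => ProjCech.Dplus k 1 {i}) b = y := by
  have e0 : ProjCech.Dplus k 1 {0} = Proj.basicOpen (ProjCech.grading k 1) (MvPolynomial.X 0) := Dplus_singleton_eq k 0
  have e1 : ProjCech.Dplus k 1 {1} = Proj.basicOpen (ProjCech.grading k 1) (MvPolynomial.X 1) := Dplus_singleton_eq k 1
  have e01 : ProjCech.Dplus k 1 {0} ⊓ ProjCech.Dplus k 1 {1} =
      Proj.basicOpen (ProjCech.grading k 1) (MvPolynomial.X 0 * MvPolynomial.X 1 : MvPolynomial (Fin 2) k) := by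
    rw [e0, e1, Proj.basicOpen_mul]
  -- the transport `φ : Γ(D₊X_{{0}} ∩ D₊X_{{1}}) → Γ(D₊(x₀x₁))` along the equality of opens (injective)
  let φ := (ProjCech.PP k 1).presheaf.map (eqToHom e01.symm).op
  have hφ : Function.Injective φ :=
    ((ProjCech.PP k 1).presheaf.mapIso (eqToIso e01.symm).op).commRingCatIsoToRingEquiv.injective
  have key : ∀ (W₁ W : (ProjCech.PP k 1).Opens) (r : Γ(ProjCech.PP k 1, W))
      (γ : W₁ ⟶ W) (α : ProjCech.Dplus k 1 {0} ⊓ ProjCech.Dplus k 1 {1} ⟶ W₁)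
      (β : Proj.basicOpen (ProjCech.grading k 1) (MvPolynomial.X 0 * MvPolynomial.X 1 : MvPolynomial (Fin 2) k) ⟶ W),
      φ ((ProjCech.PP k 1).presheaf.map α.op ((ProjCech.PP k 1).presheaf.map γ.op r)) =
        (ProjCech.PP k 1).presheaf.map β.op r := by
    intro W₁ W r γ α β
    change ((ProjCech.PP k 1).presheaf.map (eqToHom e01.symm).op) _ = _
    rw [← CategoryTheory.comp_apply, ← Functor.map_comp, ← CategoryTheory.comp_apply, ← Functor.map_comp,
      show γ.op ≫ α.op ≫ (eqToHom e01.symm).op = β.op from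
        congrArg Quiver.Hom.op (Subsingleton.elim ((eqToHom e01.symm ≫ α) ≫ γ) β)]
  -- decompose the transported section
  obtain ⟨p, q, hpq⟩ := exists_add_of_basicOpen_mul k (φ y)
  let b0 : MSections (ProjCech.toSpec k 1) (unitModule (ProjCech.PP k 1)) (ProjCech.Dplus k 1 {0}) :=
    show Γ(ProjCech.PP k 1, ProjCech.Dplus k 1 {0}) from (ProjCech.PP k 1).presheaf.map (eqToHom e0).op (-p)
  let b1 : MSections (ProjCech.toSpec k 1) (unitModule (ProjCech.PP k 1)) (ProjCech.Dplus k 1 {1}) :=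
    show Γ(ProjCech.PP k 1, ProjCech.Dplus k 1 {1}) from (ProjCech.PP k 1).presheaf.map (eqToHom e1).op q
  refine ⟨Fin.cons b0 (Fin.cons b1 fun i => Fin.elim0 i), ?_⟩
  rw [cechDelta_apply]
  apply hφ
  change φ ((ProjCech.PP k 1).presheaf.map (homOfLE inf_le_right).op ((ProjCech.PP k 1).presheaf.map (eqToHom e1).op q) -
      (ProjCech.PP k 1).presheaf.map (homOfLE inf_le_left).op ((ProjCech.PP k 1).presheaf.map (eqToHom e0).op (-p))) = φ y
  rw [map_sub, key _ _ q (eqToHom e1) (homOfLE inf_le_right) (homOfLE (Proj.basicOpen_mono _ _ _ ⟨_, mul_comm _ _⟩)),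
    key _ _ (-p) (eqToHom e0) (homOfLE inf_le_left) (homOfLE (Proj.basicOpen_mono _ _ _ ⟨_, rfl⟩)), map_neg, hpq]
  ring

/-- **`Ȟ¹((D₊x₀, D₊x₁); 𝒪_{ℙ¹_k}) = 0`**: the first Čech cohomology of the structure sheaf of the projective line over a field on
the two standard charts vanishes (`k[t,t⁻¹] = k[t] + k[t⁻¹]`; Hartshorne III.5.1 for `r = 1`, `n = 0`). [folklore] -/
theorem subsingleton_cechMH1_unit_projectiveLine :
    Subsingleton (CechMH1 (ProjCech.toSpec k 1) (unitModule (ProjCech.PP k 1)) (fun i : Fin 2 => ProjCech.Dplus k 1 {i})) :=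
  (subsingleton_cechMH1_iff _ _ _).mpr (exists_cechDelta_eq_unit k)

end StructureSheaf

end Summit.ResolutionOfSingularities.ResolutionOfSingularities.Cruxes.EquisingularLiftNat.P1VB

end
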